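/-
Copyright (c) 2026 the pub-hodgecm-mathlib formalisation cell (harness21).  Prover seat hodgecm-mathlib-LD2-p02 (g6), the DOORS file of ROAD O (dealt BY
NAME, chair LD1-plan (g3), HANDS v6 2026-09-02T13:17:00Z), half-A line LD (crux `hLiu418` = stmt-HodgeConjecture-24832), 2026-09-02.
THEOREMS ONLY (no definition, no named fact, no `sorry`, no instance, no notation).  `--supports stmt-HodgeConjecture-24832` (helper).
-/
import Summits.HodgeConjecture.HodgeConjecture.Theorems.F0LD2ArchSignOfTorusCovariant
import Summits.HodgeConjecture.HodgeConjecture.Theorems.F0LD1UnitaryEquivTransport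
import Summits.HodgeConjecture.HodgeConjecture.Theorems.F0LD2CurveHolCotFormsArchCentre
import HarnessLib

/-!
# Crux `HLiu418`, line LD — ROAD O, the DOORS: the three vector-law binders of the Hodge-free bricks (β), (δ), (β-away) hold on EVERY
# discrete `P′` unitarily equivalent to a holomorphic-cotangent `P₀`

Cell hodgecm-mathlib FLOOR 0, programme P6, half-A line LD (crux `hLiu418` = `stmt-HodgeConjecture-24832`), ROAD O («orthogonal copy», memo
`F0/P6/LD/LD1-p01/g5/ROAD-O-orthogonal-copy.v1.LD1-p01g5.md`; line card `F0/P6/LD/LD1-plan/g3/ROAD-O.linecard.v1.LD1-plan-g3.md`).  The Hodge-free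
bricks replace the function-space binder `P.IsHolCotangentAt₂ … 𝔣` of the ★ organs by VECTOR LAWS on `P`:
* (β) ★ `F0LD2ArchSignOfTorusCovariant` (p851566) — `hcov P` «for every cone frame `𝔣′` at `w₀`, a non-zero `w ∈ P` on which the torus of `𝔣′` acts
  by the cotangent character»;
* (δ) ★ `F0LD2ThetaFinComponentOfArchCentre` (p851555) — `harch P` «the archimedean centre `(y,1)·1₂` fixes `P` pointwise»;
* (β-away) `F0LD1ArchTypeAwayOfInvariant` (LD1-p02 (g6)) — `hinv P` «a non-zero `w ∈ P` fixed by the compact factor `K_c(w₀) = (ker archAt w₀).map archToAdelic`».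
Each law is an OPERATOR LAW `R(x) w = c • w` (or a law on all of `P`), so it TRAVELS along an intertwining equivalence (★ (T1)(T2)
`F0LD1UnitaryEquivTransport`, p851548; [Dixmier1977, §13.1.3]).  This file OPENS THE DOORS once and for all: for a discrete `P₀` holomorphic-cotangent
at `w₀` for a cone frame `𝔣` and ANY discrete `P′` with `P₀ ≃ᵤ P′` (`ContRepresentation.AreUnitarilyEquivalent P₀.space.toContRep P′.space.toContRep`,
the glue's (g1) currency), the three binders hold AT `P′` in the consumers' shapes VERBATIM — so the pin assembly `F0LD1ThetaSpanPinOfBricks` (LD1-p01 (g5))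
opens each brick at the theta spans `Q`, `Q′`, `Q″ ≃ᵤ P₀` with ONE call, and at `P₀` itself with `AreUnitarilyEquivalent.refl _`.

* §1 HOL DOORS at `P₀` (hol₂ enters here and only here): `archCentre_fixed_of_isHolCotangentAt₂` (`harch P₀`: the centre acts through `ψ` (★
  `exists_centralCharacter_adelicCenter`) and `ψ((y,1)) = 1` by ★ `centralCharacter_archCentre_eq_one₂` on the hol test vector), `kcInvariant_of_isHolCotangentAt₂`
  (`hinv P₀`: the hol test vector, ★ `rightRegular_eq_self_of_mem_kerArchAt₂`); `hcov P₀` is ★ (β) §1 `torusCovariant_of_isHolCotangentAt₂` (not restated).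
* §2 TRANSPORTED DOORS at `P′`: **`torusCovariant_of_areUnitarilyEquivalent`** (door-β; ★ (T1d) with index `i := (γ, q, a)`, guard
  `q ≠ 0 ∧ γ v₀′ = q v₀′ ∧ γ t₀′ = a t₀′`), **`archCentre_fixed_of_areUnitarilyEquivalent`** (door-δ; ★ (T1e) with `c := 1`),
  **`kcInvariant_of_areUnitarilyEquivalent`** (door-away; ★ (T1d) with index `k`, `c := 1`).

HONEST SCOPE.  Helpers (`--supports`); no organ, no line and not HC_CM is proved here — HC_CM stays conditional on the remaining printed inputs (hLiu418,
h413) until rung 0 closes; (B6) is BYPASSED by ROAD O for hol `P` only, and nothing moves until the leaves' ED. 11 is BUILT.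
References: [Liu2021] arXiv:2102.11518, App. D Lem. D.2 (3) (p. 127–128), proof of Prop. 4.13 Case 1 (l. 2137–2141, p. 48), proof of Cor. B.6 (3)
(p. 99); [Dixmier1977] §13.1.3; [DeitmarEchterhoff2014] Lemma 6.1.7, Thm. 7.3.2; [BorelJacquet1979] §4.1, §4.6; [Borel1997] §5.13–§5.14.
-/

set_option autoImplicit false
set_option linter.dupNamespace false

noncomputable section

open NumberField NumberField.InfinitePlace MeasureTheory IsDedekindDomain Matrix
open scoped Matrix ComplexOrder ENNReal ComplexConjugate

namespace Summit.HodgeConjecture.HodgeConjecture.Cruxes.HLiu418.F0LD1ThetaSpanDoorsOfEquiv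

open _root_.MeasureTheory
open Literature.NumberTheory.Automorphic Literature.NumberTheory.Automorphic.UnitaryGroup
open Literature.NumberTheory.Automorphic.UnitaryGroup.CotangentForms (toQuotFun)
open Literature.NumberTheory.Automorphic.UnitaryCurveForms
open Literature.AlgebraicGeometry.ShimuraVarieties Literature.Geometry.ComplexHyperbolic
open Summit.HodgeConjecture.HodgeConjecture.Cruxes.HLiu418.F0LD2CurveHolTestVector
  (exists_toLp_ne_zero_of_isHolCotangentAt₂ rightRegular_eq_self_of_mem_kerArchAt₂)
open Summit.HodgeConjecture.HodgeConjecture.Cruxes.HLiu418.F0LD2CurveHolCotFormsArchCentre (centralCharacter_archCentre_eq_one₂)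
open Summit.HodgeConjecture.HodgeConjecture.Cruxes.HLiu418.F0LD1UnitaryEquivTransport
open Summit.HodgeConjecture.HodgeConjecture.Cruxes.HLiu418.F0LD2ArchSignOfTorusCovariant (torusCovariant_of_isHolCotangentAt₂)

variable (L : Type) [Field L] [NumberField L] [IsCMField L] (H : Matrix (Fin 2) (Fin 2) L)
  (w₀ : {w : InfinitePlace L // w.IsComplex})
  {μA : Measure (adelicGroupData (↥(maximalRealSubfield L)) L (IsCMField.complexConj L) 2 H).automorphicQuotient}
  [(adelicGroupData (↥(maximalRealSubfield L)) L (IsCMField.complexConj L) 2 H).IsAutomorphicMeasure μA]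
  (𝔣 : ConeFrame L H w₀)

/-! ## §1 The hol doors at `P₀` -/

/-- **(door-δ at `P₀`) THE ARCHIMEDEAN CENTRE FIXES A HOLOMORPHIC-COTANGENT `P₀` POINTWISE** — the `harch` binder of ★
`F0LD2ThetaFinComponentOfArchCentre.thetaFinComponent₂_of_archCentre_fixed` at `P₀`: the centre `U(1)(𝔸)` acts on the irreducible `P₀` through a character
`ψ` (★ `DiscreteAutomorphicRep.exists_centralCharacter_adelicCenter`), and `ψ((y,1)) = 1` for every archimedean norm-one unit `y` because `P₀` contains the
non-zero class of a holomorphic cotangent form (★ `centralCharacter_archCentre_eq_one₂`, [Liu2021, l. 2137 «`χ_∞ = 1`»]).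
[cite: Liu2021, proof of Prop. 4.13 Case 1 (l. 2137, p. 48)] [cite: BorelJacquet1979, §4.6] -/
theorem archCentre_fixed_of_isHolCotangentAt₂
    (P₀ : DiscreteAutomorphicRep (adelicGroupData (↥(maximalRealSubfield L)) L (IsCMField.complexConj L) 2 H) μA)
    (hhol : P₀.IsHolCotangentAt₂ (IsCMField.complexConj_ne_one L) (UnitaryGroup.complexConj_smul_infinitePlace L) w₀ 𝔣) :
    ∀ (y : ↥(Literature.NumberTheory.Automorphic.relNormOneInfUnits (↥(maximalRealSubfield L)) L)) (v : P₀.space.toSubmodule),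
      P₀.space.toContRep (adelicCenter (↥(maximalRealSubfield L)) L (IsCMField.complexConj L) 2 H
        ((cmAdelicOneEquivRelNormOne L).symm (Literature.NumberTheory.Automorphic.relNormOneInfToIdeles (↥(maximalRealSubfield L)) L y))) v = v := by
  intro y v
  obtain ⟨ψ, -, -, -, hψ⟩ := P₀.exists_centralCharacter_adelicCenter
  obtain ⟨fh, hfh, hfm, hfmem, hfne⟩ := exists_toLp_ne_zero_of_isHolCotangentAt₂ (μ := μA) P₀ hhol
  have h1 := centralCharacter_archCentre_eq_one₂ P₀ hψ hfh hfm hfmem hfne y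
  have h2 := hψ ((cmAdelicOneEquivRelNormOne L).symm (Literature.NumberTheory.Automorphic.relNormOneInfToIdeles (↥(maximalRealSubfield L)) L y)) v
  rw [h1, Units.val_one, one_smul] at h2
  exact h2

/-- **(door-away at `P₀`) A HOLOMORPHIC-COTANGENT `P₀` HAS A NON-ZERO `K_c(w₀)`-FIXED VECTOR** — the `hinv` binder of (β-away)
`F0LD1ArchTypeAwayOfInvariant` (LD1-p02 (g6)) at `P₀`: the class of the hol test vector (★ `exists_toLp_ne_zero_of_isHolCotangentAt₂`), fixed by every
`k ∈ K_c(w₀) = (ker archAt w₀).map archToAdelic` (★ `rightRegular_eq_self_of_mem_kerArchAt₂`: clause (Kc) of ★ `holCotForms₂` lifted to `P₀` —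
«`P₀` is the trivial type at every complex place `≠ w₀`»). [cite: BorelJacquet1979, §4.6] [cite: DeitmarEchterhoff2014, Thm. 7.3.2]
[cite: Liu2021, proof of Prop. 4.13 Case 1 (l. 2137–2141, p. 48)] -/
theorem kcInvariant_of_isHolCotangentAt₂
    (P₀ : DiscreteAutomorphicRep (adelicGroupData (↥(maximalRealSubfield L)) L (IsCMField.complexConj L) 2 H) μA)
    (hhol : P₀.IsHolCotangentAt₂ (IsCMField.complexConj_ne_one L) (UnitaryGroup.complexConj_smul_infinitePlace L) w₀ 𝔣) :
    ∃ w ∈ P₀.space.toSubmodule, w ≠ 0 ∧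
      ∀ k ∈ ((archAt (↥(maximalRealSubfield L)) L (IsCMField.complexConj L) 2 H w₀ (UnitaryGroup.complexConj_smul_infinitePlace L w₀.1)
          (IsCMField.complexConj_ne_one L)).ker).map (archToAdelic (↥(maximalRealSubfield L)) L (IsCMField.complexConj L) 2 H),
        (adelicGroupData (↥(maximalRealSubfield L)) L (IsCMField.complexConj L) 2 H).rightRegular μA k w = w := by
  obtain ⟨fh, hfh, hfm, hfmem, hfne⟩ := exists_toLp_ne_zero_of_isHolCotangentAt₂ (μ := μA) P₀ hhol
  exact ⟨hfm.toLp _, hfmem, hfne, fun k hk => rightRegular_eq_self_of_mem_kerArchAt₂ P₀ hfh hfm hfmem hfne hk hfmem⟩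

/-! ## §2 The transported doors at any `P′ ≃ᵤ P₀` -/

/-- **(door-β) TORUS COVARIANCE AT `P′ ≃ᵤ P₀`** — the `hcov` binder of ★ (β) `F0LD2ArchSignOfTorusCovariant.re_mul_im_lt_zero_of_meets_of_torusCovariant` ∕
`im_mul_im_pos_of_meets_of_torusCovariant` AT `P′`, verbatim: for every cone frame `𝔣′` of `H` at `w₀` there is a non-zero `w ∈ P′` with
`R(ι γ) w = (a q⁻¹) • w` for every `γ ∈ U(σ_{w₀}H)(ℂ)` diagonal in `𝔣′` (`γ v₀′ = q v₀′`, `γ t₀′ = a t₀′`, `q ≠ 0`) — ★ §1 `torusCovariant_of_isHolCotangentAt₂` at `P₀`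
(scaled frame `ᵗ(c̄ g)(t•H)g = diag dV`, `c̄ dV = dV`, any phase of `σ_{w₀}(t)`) pushed through `P₀ ≃ᵤ P′` by ★ (T1d) `exists_mem_ne_zero_laws_of_areUnitarilyEquivalent`
with the guarded family indexed by `i := (γ, q, a)`. [cite: Liu2021, App. D Lem. D.2 (3) (p. 127 L40 – p. 128 L2)] [cite: Dixmier1977, §13.1.3] [cite: Borel1997, §5.13–§5.14] -/
theorem torusCovariant_of_areUnitarilyEquivalent (dV : Fin 2 → L) (hdV : ∀ i, IsCMField.complexConj L (dV i) = dV i) (t : L) (ht : t ≠ 0)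
    (g : GL (Fin 2) L) (hg : formCongr ((IsCMField.complexConj L : L ≃ₐ[↥(maximalRealSubfield L)] L) : L →+* L) g (t • H) = Matrix.diagonal dV)
    [CompactSpace (adelicGroupData (↥(maximalRealSubfield L)) L (IsCMField.complexConj L) 2 H).automorphicQuotient]
    (P₀ P' : DiscreteAutomorphicRep (adelicGroupData (↥(maximalRealSubfield L)) L (IsCMField.complexConj L) 2 H) μA)
    (hhol : P₀.IsHolCotangentAt₂ (IsCMField.complexConj_ne_one L) (UnitaryGroup.complexConj_smul_infinitePlace L) w₀ 𝔣)
    (he : ContRepresentation.AreUnitarilyEquivalent P₀.space.toContRep P'.space.toContRep) :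
    ∀ 𝔣' : ConeFrame L H w₀, ∃ w ∈ P'.space.toSubmodule, w ≠ 0 ∧
      ∀ (γ : archLocal L 2 H w₀) (q a : ℂ), q ≠ 0 →
        ((γ : GL (Fin 2) ℂ) : Matrix (Fin 2) (Fin 2) ℂ) *ᵥ 𝔣'.v₀ = q • 𝔣'.v₀ →
        ((γ : GL (Fin 2) ℂ) : Matrix (Fin 2) (Fin 2) ℂ) *ᵥ 𝔣'.t₀ = a • 𝔣'.t₀ →
          (adelicGroupData (↥(maximalRealSubfield L)) L (IsCMField.complexConj L) 2 H).rightRegular μA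
              (UnitaryGroup.adelicSingle (↥(maximalRealSubfield L)) L (IsCMField.complexConj L) 2 H (IsCMField.complexConj_ne_one L)
                (UnitaryGroup.complexConj_smul_infinitePlace L) w₀ γ) w = (a * q⁻¹) • w := by
  intro 𝔣'
  have h0 := torusCovariant_of_isHolCotangentAt₂ L H dV hdV t ht g hg w₀ 𝔣 P₀ hhol 𝔣'
  -- the guarded family of laws indexed by `i := (γ, q, a)`
  have h1 := exists_mem_ne_zero_laws_of_areUnitarilyEquivalent he (ι := archLocal L 2 H w₀ × ℂ × ℂ)
    (fun i => i.2.1 ≠ 0 ∧ ((i.1 : GL (Fin 2) ℂ) : Matrix (Fin 2) (Fin 2) ℂ) *ᵥ 𝔣'.v₀ = i.2.1 • 𝔣'.v₀ ∧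
      ((i.1 : GL (Fin 2) ℂ) : Matrix (Fin 2) (Fin 2) ℂ) *ᵥ 𝔣'.t₀ = i.2.2 • 𝔣'.t₀)
    (fun i => UnitaryGroup.adelicSingle (↥(maximalRealSubfield L)) L (IsCMField.complexConj L) 2 H (IsCMField.complexConj_ne_one L)
      (UnitaryGroup.complexConj_smul_infinitePlace L) w₀ i.1)
    (fun i => i.2.2 * i.2.1⁻¹)
    (by
      obtain ⟨w, hw, hw0, hlaw⟩ := h0
      exact ⟨w, hw, hw0, fun i hi => hlaw i.1 i.2.1 i.2.2 hi.1 hi.2.1 hi.2.2⟩)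
  obtain ⟨w, hw, hw0, hlaw⟩ := h1
  exact ⟨w, hw, hw0, fun γ q a hq hγv hγt => hlaw ⟨γ, q, a⟩ ⟨hq, hγv, hγt⟩⟩

/-- **(door-δ) THE ARCHIMEDEAN CENTRE FIXES EVERY `P′ ≃ᵤ P₀` POINTWISE** — the `harch` binder of ★ (δ) `thetaFinComponent₂_of_archCentre_fixed` AT `P′`,
verbatim (§1 at `P₀`, then the law on all of `P₀` holds on all of `P′`: ★ (T1e) `toContRep_apply_eq_smul_of_areUnitarilyEquivalent` with `c := 1`;
equivalently (T2) + `ψ((y,1)) = 1`). [cite: Liu2021, proof of Prop. 4.13 Case 1 (l. 2137, p. 48)] [cite: BorelJacquet1979, §4.6] [cite: Dixmier1977, §13.1.3] -/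
theorem archCentre_fixed_of_areUnitarilyEquivalent
    (P₀ P' : DiscreteAutomorphicRep (adelicGroupData (↥(maximalRealSubfield L)) L (IsCMField.complexConj L) 2 H) μA)
    (hhol : P₀.IsHolCotangentAt₂ (IsCMField.complexConj_ne_one L) (UnitaryGroup.complexConj_smul_infinitePlace L) w₀ 𝔣)
    (he : ContRepresentation.AreUnitarilyEquivalent P₀.space.toContRep P'.space.toContRep) :
    ∀ (y : ↥(Literature.NumberTheory.Automorphic.relNormOneInfUnits (↥(maximalRealSubfield L)) L)) (v : P'.space.toSubmodule),
      P'.space.toContRep (adelicCenter (↥(maximalRealSubfield L)) L (IsCMField.complexConj L) 2 H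
        ((cmAdelicOneEquivRelNormOne L).symm (Literature.NumberTheory.Automorphic.relNormOneInfToIdeles (↥(maximalRealSubfield L)) L y))) v = v := by
  intro y v
  have h0 := archCentre_fixed_of_isHolCotangentAt₂ L H w₀ 𝔣 P₀ hhol y
  have h1 := toContRep_apply_eq_smul_of_areUnitarilyEquivalent he (c := (1 : ℂ)) (fun u => by rw [one_smul]; exact h0 u) v
  rw [one_smul] at h1
  exact h1

/-- **(door-away) EVERY `P′ ≃ᵤ P₀` HAS A NON-ZERO `K_c(w₀)`-FIXED VECTOR** — the `hinv` binder of (β-away) `F0LD1ArchTypeAwayOfInvariant` AT `P′`, verbatim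
(§1 at `P₀`, pushed through `P₀ ≃ᵤ P′` by ★ (T1d) `exists_mem_ne_zero_laws_of_areUnitarilyEquivalent` with index `k`, guard `k ∈ K_c(w₀)`, `c := 1`).
[cite: BorelJacquet1979, §4.6] [cite: DeitmarEchterhoff2014, Thm. 7.3.2] [cite: Dixmier1977, §13.1.3] -/
theorem kcInvariant_of_areUnitarilyEquivalent
    (P₀ P' : DiscreteAutomorphicRep (adelicGroupData (↥(maximalRealSubfield L)) L (IsCMField.complexConj L) 2 H) μA)
    (hhol : P₀.IsHolCotangentAt₂ (IsCMField.complexConj_ne_one L) (UnitaryGroup.complexConj_smul_infinitePlace L) w₀ 𝔣)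
    (he : ContRepresentation.AreUnitarilyEquivalent P₀.space.toContRep P'.space.toContRep) :
    ∃ w ∈ P'.space.toSubmodule, w ≠ 0 ∧
      ∀ k ∈ ((archAt (↥(maximalRealSubfield L)) L (IsCMField.complexConj L) 2 H w₀ (UnitaryGroup.complexConj_smul_infinitePlace L w₀.1)
          (IsCMField.complexConj_ne_one L)).ker).map (archToAdelic (↥(maximalRealSubfield L)) L (IsCMField.complexConj L) 2 H),
        (adelicGroupData (↥(maximalRealSubfield L)) L (IsCMField.complexConj L) 2 H).rightRegular μA k w = w := by
  have h0 := kcInvariant_of_isHolCotangentAt₂ L H w₀ 𝔣 P₀ hhol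
  have h1 := exists_mem_ne_zero_laws_of_areUnitarilyEquivalent he
    (fun k => k ∈ ((archAt (↥(maximalRealSubfield L)) L (IsCMField.complexConj L) 2 H w₀
        (UnitaryGroup.complexConj_smul_infinitePlace L w₀.1) (IsCMField.complexConj_ne_one L)).ker).map
          (archToAdelic (↥(maximalRealSubfield L)) L (IsCMField.complexConj L) 2 H))
    (fun k => k) (fun _ => (1 : ℂ))
    (by
      obtain ⟨w, hw, hw0, hlaw⟩ := h0
      exact ⟨w, hw, hw0, fun k hk => by rw [one_smul]; exact hlaw k hk⟩)
  obtain ⟨w, hw, hw0, hlaw⟩ := h1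
  exact ⟨w, hw, hw0, fun k hk => by have h2 := hlaw k hk; rwa [one_smul] at h2⟩

end Summit.HodgeConjecture.HodgeConjecture.Cruxes.HLiu418.F0LD1ThetaSpanDoorsOfEquiv

end
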